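import Literature.Algebra.Lie.EnvelopingAlgebraProduct
import Literature.NumberTheory.Automorphic.ArchimedeanGLn
import Mathlib.Algebra.Algebra.Pi
import Mathlib.Data.Fintype.Option
import HarnessLib

/-!
# The centre of `U(𝔤𝔩_m(A))` for a finite product `A = ∏ᵢ Aᵢ` of coefficient algebras

Topic `NumberTheory/Automorphic` (the coefficient algebra of interest is
`K_∞ = mixedSpace K = ∏_{w real} ℝ × ∏_{w complex} ℂ`, whose factors embed by the non-unital maps
`realPlaceHom`, `complexPlaceHom` of `ArchimedeanGLn`). For a commutative `𝕂`-algebra written as a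
finite product of commutative `𝕂`-algebras, `𝔤𝔩_m(∏ᵢ Aᵢ) = ⨁ᵢ 𝔤𝔩_m(Aᵢ)` as Lie algebras over `𝕂`
with pairwise commuting (indeed mutually annihilating) summands, so by the product theorem for
enveloping algebras (`Literature.Algebra.Lie.UEnvProduct.center_le_adjoin`: `U(L₁ × L₂) = U(L₁) ⊗ U(L₂)`
and `Z(U(L₁ × L₂)) = Z(U(L₁)) ⊗ Z(U(L₂))`; Dixmier 2.2.10, 4.2) **the centre of `U(𝔤𝔩_m(∏ᵢ Aᵢ))`
is generated by the images of the centres of the `U(𝔤𝔩_m(Aᵢ))`** under the maps induced by the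
coordinate inclusions `Aᵢ → ∏ Aᵢ` (non-unital algebra maps; `mapMatrixLie` of `ArchimedeanGLn`,
`UEnvProduct.envMap`):

* `center_matrix_prod_le_adjoin` — the binary case `A × B` (inclusions `NonUnitalAlgHom.inl/inr`);
* `center_le_adjoin_of_algEquiv` — transport along an isomorphism of coefficient algebras;
* `center_matrix_pi_le_adjoin` — **`Z(U(𝔤𝔩_m(ι → 𝕜))) ≤ adjoin (⋃ᵢ U(singleᵢ)(Z(U(𝔤𝔩_m(𝕜)))))`** for a
  finite index type `ι` (`Fintype.induction_empty_option`: the empty product is the zero ring, and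
  `Option ι → 𝕜 ≅ 𝕜 × (ι → 𝕜)`);
* `center_matrix_mixedSpace_le_adjoin` — **for a number field `K`, the centre of `U(𝔤𝔩_m(K_∞))` is
  contained in the subalgebra generated by the images of the centres of the factors
  `U(𝔤𝔩_m(ℝ))` (`w` real, via `realPlaceHom w`) and `U(𝔤𝔩_m(ℂ))` (`w` complex, via
  `complexPlaceHom w`)** — Clozel 1990, §3.3 (`𝔤_∞ = ⨁_w 𝔤𝔩_m(K_w)`), the structural input that
  makes "finite under `Z(U(𝔤𝔩_m(K_w)))` for every archimedean place `w`" the same as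
  `Z(𝔤_∞)`-finite in Harish-Chandra's finiteness theorem (Borel–Jacquet 1979, 4.3 (i)).

Everything here is proved; the definitions are the coefficient-algebra maps and equivalences used
(`matrixProdLinearEquiv`, `mapMatrixLieEquiv`, `singleNonUnitalAlgHom`, `piOptionAlgEquiv`,
`piReindexAlgEquiv`).

## References

* J. Dixmier, *Enveloping Algebras* (1977), 2.2.10, 4.2 [Dixmier1977].
* L. Clozel, *Motifs et formes automorphes* (1990), §3.3 [Clozel1990].
* A. Borel, H. Jacquet, *Automorphic forms and automorphic representations* (1979), 4.3
  [BorelJacquet1979].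
-/

noncomputable section

-- Mathlib idiom (Mathlib/Algebra/Lie/OfAssociative.lean): the commutator bracket on associative rings
attribute [local instance 100] LieRing.ofAssociativeRing

open UniversalEnvelopingAlgebra Literature.Algebra.Lie.UEnvProduct

namespace Literature.NumberTheory.Automorphic.UEnvMatrix

universe u

/-! ### 1. The binary case `𝔤𝔩_m(A × B) = 𝔤𝔩_m(A) × 𝔤𝔩_m(B)` -/

section Prod

variable {𝕂 : Type*} [Field 𝕂] {A B : Type*} [CommRing A] [Algebra 𝕂 A] [CommRing B] [Algebra 𝕂 B]
  {m : Type*} [Fintype m] [DecidableEq m]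

omit [DecidableEq m] in
/-- Matrices over `A`, included into matrices over `A × B`, annihilate matrices over `B`. [folklore] -/
theorem map_inl_mul_map_inr (X : Matrix m m A) (Y : Matrix m m B) :
    X.map (NonUnitalAlgHom.inl 𝕂 A B) * Y.map (NonUnitalAlgHom.inr 𝕂 A B) = 0 := by
  ext i j <;>
    simp only [Matrix.mul_apply, Matrix.zero_apply, Matrix.map_apply, NonUnitalAlgHom.inl_apply,
      NonUnitalAlgHom.inr_apply, Prod.mk_mul_mk, mul_zero, zero_mul, Prod.fst_zero, Prod.snd_zero,
      Prod.fst_sum, Prod.snd_sum, Finset.sum_const_zero]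

omit [DecidableEq m] in
/-- Matrices over `B`, included into matrices over `A × B`, annihilate matrices over `A`. [folklore] -/
theorem map_inr_mul_map_inl (X : Matrix m m A) (Y : Matrix m m B) :
    Y.map (NonUnitalAlgHom.inr 𝕂 A B) * X.map (NonUnitalAlgHom.inl 𝕂 A B) = 0 := by
  ext i j <;>
    simp only [Matrix.mul_apply, Matrix.zero_apply, Matrix.map_apply, NonUnitalAlgHom.inl_apply,
      NonUnitalAlgHom.inr_apply, Prod.mk_mul_mk, mul_zero, zero_mul, Prod.fst_zero, Prod.snd_zero,
      Prod.fst_sum, Prod.snd_sum, Finset.sum_const_zero]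

/-- **The two summands `𝔤𝔩_m(A), 𝔤𝔩_m(B) ⊆ 𝔤𝔩_m(A × B)` commute.** [folklore] -/
theorem lie_mapMatrixLie_inl_inr (X : Matrix m m A) (Y : Matrix m m B) :
    ⁅mapMatrixLie (N := m) (NonUnitalAlgHom.inl 𝕂 A B) X, mapMatrixLie (N := m) (NonUnitalAlgHom.inr 𝕂 A B) Y⁆ = 0 := by
  rw [mapMatrixLie_apply, mapMatrixLie_apply, Ring.lie_def, map_inl_mul_map_inr, map_inr_mul_map_inl, sub_zero]

variable (𝕂 A B m) in
/-- **`𝔤𝔩_m(A) × 𝔤𝔩_m(B) ≅ 𝔤𝔩_m(A × B)`** as `𝕂`-modules: a pair of matrices is the matrix of pairs.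
[folklore] -/
def matrixProdLinearEquiv : (Matrix m m A × Matrix m m B) ≃ₗ[𝕂] Matrix m m (A × B) where
  toFun p := Matrix.of fun i j => (p.1 i j, p.2 i j)
  invFun Z := (Z.map Prod.fst, Z.map Prod.snd)
  map_add' p q := by ext i j <;> rfl
  map_smul' c p := by ext i j <;> rfl
  left_inv p := by
    rcases p with ⟨X, Y⟩
    rfl
  right_inv Z := by
    ext i j <;> rfl

/-- On the first summand the equivalence is the inclusion `inl`. [folklore] -/
theorem matrixProdLinearEquiv_inl (X : Matrix m m A) :
    matrixProdLinearEquiv 𝕂 A B m (X, 0) = mapMatrixLie (N := m) (NonUnitalAlgHom.inl 𝕂 A B) X := by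
  ext i j
  · rfl
  · change (0 : Matrix m m B) i j = (NonUnitalAlgHom.inl 𝕂 A B (X i j)).2
    rw [NonUnitalAlgHom.inl_apply, Matrix.zero_apply]

/-- On the second summand the equivalence is the inclusion `inr`. [folklore] -/
theorem matrixProdLinearEquiv_inr (Y : Matrix m m B) :
    matrixProdLinearEquiv 𝕂 A B m (0, Y) = mapMatrixLie (N := m) (NonUnitalAlgHom.inr 𝕂 A B) Y := by
  ext i j
  · change (0 : Matrix m m A) i j = (NonUnitalAlgHom.inr 𝕂 A B (Y i j)).1
    rw [NonUnitalAlgHom.inr_apply, Matrix.zero_apply]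
  · rfl

/-- **The centre of `U(𝔤𝔩_m(A × B))` is generated by the images of the centres of `U(𝔤𝔩_m(A))` and
`U(𝔤𝔩_m(B))`** (product theorem for enveloping algebras, `UEnvProduct.center_le_adjoin`).
[cite: Dixmier1977, 2.2.10 and 4.2] -/
theorem center_matrix_prod_le_adjoin :
    Subalgebra.center 𝕂 (UniversalEnvelopingAlgebra 𝕂 (Matrix m m (A × B))) ≤
      Algebra.adjoin 𝕂
        (envMap (mapMatrixLie (N := m) (NonUnitalAlgHom.inl 𝕂 A B)) ''
            (Subalgebra.center 𝕂 (UniversalEnvelopingAlgebra 𝕂 (Matrix m m A)) : Set _) ∪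
          envMap (mapMatrixLie (N := m) (NonUnitalAlgHom.inr 𝕂 A B)) ''
            (Subalgebra.center 𝕂 (UniversalEnvelopingAlgebra 𝕂 (Matrix m m B)) : Set _)) :=
  center_le_adjoin lie_mapMatrixLie_inl_inr (matrixProdLinearEquiv 𝕂 A B m)
    matrixProdLinearEquiv_inl matrixProdLinearEquiv_inr

end Prod

/-! ### 2. Functoriality in the coefficient algebra -/

section Transport

variable {𝕂 : Type*} [Field 𝕂] {A B C : Type*} [CommRing A] [Algebra 𝕂 A] [CommRing B] [Algebra 𝕂 B]
  [CommRing C] [Algebra 𝕂 C] {m : Type*} [Fintype m] [DecidableEq m]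

/-- `mapMatrixLie` is functorial: `mapMatrixLie (g ∘ f) = mapMatrixLie g ∘ mapMatrixLie f`. [folklore] -/
theorem mapMatrixLie_comp (g : B →ₙₐ[𝕂] C) (f : A →ₙₐ[𝕂] B) :
    mapMatrixLie (N := m) (g.comp f) = (mapMatrixLie (N := m) g).comp (mapMatrixLie (N := m) f) := by
  ext X i j
  rfl

/-- `envMap` is functorial: `U(g ∘ f) = U(g) ∘ U(f)`. [folklore] -/
theorem envMap_comp {L₁ L₂ L₃ : Type*} [LieRing L₁] [LieAlgebra 𝕂 L₁] [LieRing L₂] [LieAlgebra 𝕂 L₂]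
    [LieRing L₃] [LieAlgebra 𝕂 L₃] (g : L₂ →ₗ⁅𝕂⁆ L₃) (f : L₁ →ₗ⁅𝕂⁆ L₂) :
    envMap (g.comp f) = (envMap g).comp (envMap f) := by
  refine UniversalEnvelopingAlgebra.hom_ext (h := LieHom.ext fun x => ?_)
  simp only [LieHom.coe_comp, Function.comp_apply, AlgHom.coe_toLieHom, AlgHom.coe_comp, envMap_ι]

/-- `U(id) = id`. [folklore] -/
theorem envMap_id {L₁ : Type*} [LieRing L₁] [LieAlgebra 𝕂 L₁] :
    envMap (LieHom.id : L₁ →ₗ⁅𝕂⁆ L₁) = AlgHom.id 𝕂 _ := by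
  refine UniversalEnvelopingAlgebra.hom_ext (h := LieHom.ext fun x => ?_)
  simp only [LieHom.coe_comp, Function.comp_apply, AlgHom.coe_toLieHom, envMap_ι, LieHom.id_apply]
  rfl

/-- The image of `U(g ∘ f)` of a set is the image under `U(g)` of its image under `U(f)`. [folklore] -/
theorem image_envMap_comp {L₁ L₂ L₃ : Type*} [LieRing L₁] [LieAlgebra 𝕂 L₁] [LieRing L₂] [LieAlgebra 𝕂 L₂]
    [LieRing L₃] [LieAlgebra 𝕂 L₃] (g : L₂ →ₗ⁅𝕂⁆ L₃) (f : L₁ →ₗ⁅𝕂⁆ L₂) (S : Set (UniversalEnvelopingAlgebra 𝕂 L₁)) :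
    envMap g '' (envMap f '' S) = envMap (g.comp f) '' S := by
  rw [Set.image_image, envMap_comp]
  rfl

variable (m) in
/-- **An isomorphism of coefficient algebras gives an isomorphism of matrix Lie algebras**
`𝔤𝔩_m(A) ≃ 𝔤𝔩_m(B)` (entrywise). [folklore] -/
def mapMatrixLieEquiv (e : A ≃ₐ[𝕂] B) : Matrix m m A ≃ₗ⁅𝕂⁆ Matrix m m B :=
  { mapMatrixLie (N := m) ((e : A →ₐ[𝕂] B) : A →ₙₐ[𝕂] B) with
    invFun := mapMatrixLie (N := m) ((e.symm : B →ₐ[𝕂] A) : B →ₙₐ[𝕂] A)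
    left_inv := fun X => by
      ext i j
      exact e.symm_apply_apply (X i j)
    right_inv := fun Y => by
      ext i j
      exact e.apply_symm_apply (Y i j) }

/-- The underlying Lie algebra map of `mapMatrixLieEquiv e` is `mapMatrixLie e`. [folklore] -/
theorem mapMatrixLieEquiv_toLieHom (e : A ≃ₐ[𝕂] B) :
    ((mapMatrixLieEquiv m e : Matrix m m A ≃ₗ⁅𝕂⁆ Matrix m m B) : Matrix m m A →ₗ⁅𝕂⁆ Matrix m m B) =
      mapMatrixLie (N := m) ((e : A →ₐ[𝕂] B) : A →ₙₐ[𝕂] B) :=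
  rfl

/-- The inverse of `mapMatrixLieEquiv e` is `mapMatrixLieEquiv e.symm`. [folklore] -/
theorem mapMatrixLieEquiv_symm_toLieHom (e : A ≃ₐ[𝕂] B) :
    (((mapMatrixLieEquiv m e).symm : Matrix m m B ≃ₗ⁅𝕂⁆ Matrix m m A) : Matrix m m B →ₗ⁅𝕂⁆ Matrix m m A) =
      mapMatrixLie (N := m) ((e.symm : B →ₐ[𝕂] A) : B →ₙₐ[𝕂] A) :=
  rfl

/-- `U` of a Lie algebra isomorphism is surjective (it has `U` of the inverse as a section). [folklore] -/
theorem envMap_equiv_surjective {L₁ L₂ : Type*} [LieRing L₁] [LieAlgebra 𝕂 L₁] [LieRing L₂] [LieAlgebra 𝕂 L₂]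
    (e : L₁ ≃ₗ⁅𝕂⁆ L₂) : Function.Surjective (envMap (e : L₁ →ₗ⁅𝕂⁆ L₂)) := by
  intro u
  refine ⟨envMap (e.symm : L₂ →ₗ⁅𝕂⁆ L₁) u, ?_⟩
  rw [← AlgHom.comp_apply, ← envMap_comp]
  have : (e : L₁ →ₗ⁅𝕂⁆ L₂).comp (e.symm : L₂ →ₗ⁅𝕂⁆ L₁) = LieHom.id := by
    ext x; exact e.apply_symm_apply x
  rw [this, envMap_id, AlgHom.id_apply]

/-- `U(e⁻¹) ∘ U(e) = id` for a Lie algebra isomorphism `e`. [folklore] -/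
theorem envMap_symm_envMap {L₁ L₂ : Type*} [LieRing L₁] [LieAlgebra 𝕂 L₁] [LieRing L₂] [LieAlgebra 𝕂 L₂]
    (e : L₁ ≃ₗ⁅𝕂⁆ L₂) (u : UniversalEnvelopingAlgebra 𝕂 L₁) :
    envMap (e.symm : L₂ →ₗ⁅𝕂⁆ L₁) (envMap (e : L₁ →ₗ⁅𝕂⁆ L₂) u) = u := by
  rw [← AlgHom.comp_apply, ← envMap_comp]
  have : (e.symm : L₂ →ₗ⁅𝕂⁆ L₁).comp (e : L₁ →ₗ⁅𝕂⁆ L₂) = LieHom.id := by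
    ext x; exact e.symm_apply_apply x
  rw [this, envMap_id, AlgHom.id_apply]

/-- `U` of a Lie algebra isomorphism maps the centre into the centre. [folklore] -/
theorem envMap_equiv_mem_center {L₁ L₂ : Type*} [LieRing L₁] [LieAlgebra 𝕂 L₁] [LieRing L₂] [LieAlgebra 𝕂 L₂]
    (e : L₁ ≃ₗ⁅𝕂⁆ L₂) {z : UniversalEnvelopingAlgebra 𝕂 L₁}
    (hz : z ∈ Subalgebra.center 𝕂 (UniversalEnvelopingAlgebra 𝕂 L₁)) :
    envMap (e : L₁ →ₗ⁅𝕂⁆ L₂) z ∈ Subalgebra.center 𝕂 (UniversalEnvelopingAlgebra 𝕂 L₂) := by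
  rw [Subalgebra.mem_center_iff]
  intro u
  obtain ⟨v, rfl⟩ := envMap_equiv_surjective e u
  rw [← map_mul, ← map_mul, Subalgebra.mem_center_iff.mp hz v]

/-- **Transport of generation statements along an isomorphism of coefficient algebras.** If the
centre of `U(𝔤𝔩_m(B))` is contained in the subalgebra generated by a set `S`, then the centre of
`U(𝔤𝔩_m(A))`, `A ≅ B`, is contained in the subalgebra generated by the image of `S` under
`U(𝔤𝔩_m(e⁻¹))`. [folklore] -/
theorem center_le_adjoin_of_algEquiv (e : A ≃ₐ[𝕂] B) {S : Set (UniversalEnvelopingAlgebra 𝕂 (Matrix m m B))}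
    (hS : Subalgebra.center 𝕂 (UniversalEnvelopingAlgebra 𝕂 (Matrix m m B)) ≤ Algebra.adjoin 𝕂 S) :
    Subalgebra.center 𝕂 (UniversalEnvelopingAlgebra 𝕂 (Matrix m m A)) ≤
      Algebra.adjoin 𝕂 (envMap (mapMatrixLie (N := m) ((e.symm : B →ₐ[𝕂] A) : B →ₙₐ[𝕂] A)) '' S) := by
  intro z hz
  have h1 : envMap ((mapMatrixLieEquiv m e : Matrix m m A ≃ₗ⁅𝕂⁆ Matrix m m B) : _ →ₗ⁅𝕂⁆ _) z ∈
      Algebra.adjoin 𝕂 S := hS (envMap_equiv_mem_center _ hz)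
  have h2 := Subalgebra.mem_map.mpr ⟨_, h1, envMap_symm_envMap (mapMatrixLieEquiv m e) z⟩
  rw [AlgHom.map_adjoin] at h2
  exact h2

end Transport

/-! ### 3. Finite products of copies of one coefficient algebra -/

section Pi

variable {𝕂 : Type*} [Field 𝕂] (𝕜 : Type*) [CommRing 𝕜] [Algebra 𝕂 𝕜] {m : Type*} [Fintype m] [DecidableEq m]

/-- The coordinate inclusion `𝕜 → (ι → 𝕜)`, `x ↦ Pi.single i x`, as a non-unital algebra map (it does
not preserve `1`). [folklore] -/
def singleNonUnitalAlgHom {ι : Type*} [DecidableEq ι] (i : ι) : 𝕜 →ₙₐ[𝕂] (ι → 𝕜) where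
  toFun x := Pi.single (M := fun _ : ι => 𝕜) i x
  map_smul' c x := Pi.single_smul' i c x
  map_zero' := Pi.single_zero (M := fun _ : ι => 𝕜) i
  map_add' x y := Pi.single_add (f := fun _ : ι => 𝕜) i x y
  map_mul' x y := Pi.single_mul (α := fun _ : ι => 𝕜) i x y

/-- `singleNonUnitalAlgHom 𝕜 i x = Pi.single i x`. [folklore] -/
theorem singleNonUnitalAlgHom_apply {ι : Type*} [DecidableEq ι] (i : ι) (x : 𝕜) :
    singleNonUnitalAlgHom (𝕂 := 𝕂) 𝕜 i x = Pi.single (M := fun _ : ι => 𝕜) i x :=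
  rfl

/-- Entries of `singleNonUnitalAlgHom 𝕜 i x`: `x` at `i`, `0` elsewhere. [folklore] -/
theorem singleNonUnitalAlgHom_apply_apply {ι : Type*} [DecidableEq ι] (i j : ι) (x : 𝕜) :
    singleNonUnitalAlgHom (𝕂 := 𝕂) 𝕜 i x j = if j = i then x else 0 := by
  rw [singleNonUnitalAlgHom_apply, Pi.single_apply]

/-- **`(Option ι → 𝕜) ≅ 𝕜 × (ι → 𝕜)`** as `𝕂`-algebras (`Equiv.piOptionEquivProd`, pointwise
operations). [folklore] -/
def piOptionAlgEquiv (ι : Type*) : (Option ι → 𝕜) ≃ₐ[𝕂] 𝕜 × (ι → 𝕜) :=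
  { (Equiv.piOptionEquivProd (β := fun _ : Option ι => 𝕜)) with
    map_mul' := fun _ _ => rfl
    map_add' := fun _ _ => rfl
    commutes' := fun _ => rfl }

/-- Under `(Option ι → 𝕜) ≅ 𝕜 × (ι → 𝕜)`, the first factor is the coordinate `none`. [folklore] -/
theorem piOptionAlgEquiv_symm_comp_inl (ι : Type*) [DecidableEq (Option ι)] :
    (((piOptionAlgEquiv (𝕂 := 𝕂) 𝕜 ι).symm : 𝕜 × (ι → 𝕜) →ₐ[𝕂] (Option ι → 𝕜)) :
        𝕜 × (ι → 𝕜) →ₙₐ[𝕂] (Option ι → 𝕜)).comp (NonUnitalAlgHom.inl 𝕂 𝕜 (ι → 𝕜)) =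
      singleNonUnitalAlgHom 𝕜 none := by
  refine NonUnitalAlgHom.ext fun x => funext fun a => ?_
  rw [singleNonUnitalAlgHom_apply_apply]
  cases a with
  | none => exact (if_pos rfl).symm
  | some a => exact (if_neg (Option.some_ne_none a)).symm

/-- Under `(Option ι → 𝕜) ≅ 𝕜 × (ι → 𝕜)`, the coordinate `a` of the second factor is the coordinate
`some a`. [folklore] -/
theorem piOptionAlgEquiv_symm_comp_inr_comp_single (ι : Type*) [DecidableEq ι] [DecidableEq (Option ι)]
    (a : ι) :
    ((((piOptionAlgEquiv (𝕂 := 𝕂) 𝕜 ι).symm : 𝕜 × (ι → 𝕜) →ₐ[𝕂] (Option ι → 𝕜)) :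
        𝕜 × (ι → 𝕜) →ₙₐ[𝕂] (Option ι → 𝕜)).comp (NonUnitalAlgHom.inr 𝕂 𝕜 (ι → 𝕜))).comp
        (singleNonUnitalAlgHom 𝕜 a) =
      singleNonUnitalAlgHom 𝕜 (some a) := by
  refine NonUnitalAlgHom.ext fun x => funext fun b => ?_
  rw [singleNonUnitalAlgHom_apply_apply]
  cases b with
  | none => exact (if_neg (Option.some_ne_none a).symm).symm
  | some b =>
    change singleNonUnitalAlgHom (𝕂 := 𝕂) 𝕜 a x b = _
    rw [singleNonUnitalAlgHom_apply_apply]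
    by_cases h : b = a
    · subst h
      rw [if_pos rfl, if_pos rfl]
    · rw [if_neg h, if_neg (fun h' => h (Option.some_injective _ h'))]

variable (𝕂) in
/-- **Reindexing a product of copies of `𝕜`** as a `𝕂`-algebra isomorphism `(ι → 𝕜) ≅ (ι' → 𝕜)` along
`e : ι ≃ ι'` (`f ↦ f ∘ e⁻¹`; the non-dependent form of `AlgEquiv.piCongrLeft'`, with definitional
inverse `g ↦ g ∘ e`). [folklore] -/
def piReindexAlgEquiv {ι ι' : Type*} (e : ι ≃ ι') : (ι → 𝕜) ≃ₐ[𝕂] (ι' → 𝕜) where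
  toFun f := f ∘ e.symm
  invFun g := g ∘ e
  left_inv f := funext fun i => by simp
  right_inv g := funext fun i' => by simp
  map_mul' _ _ := rfl
  map_add' _ _ := rfl
  commutes' _ := rfl

/-- Transport of the coordinate inclusions along a reindexing of the product. [folklore] -/
theorem piReindexAlgEquiv_symm_comp_single {ι ι' : Type*} [DecidableEq ι] [DecidableEq ι'] (e : ι ≃ ι')
    (i : ι) :
    (((piReindexAlgEquiv 𝕂 𝕜 e).symm : (ι' → 𝕜) →ₐ[𝕂] (ι → 𝕜)) : (ι' → 𝕜) →ₙₐ[𝕂] (ι → 𝕜)).comp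
        (singleNonUnitalAlgHom 𝕜 (e i)) =
      singleNonUnitalAlgHom 𝕜 i := by
  refine NonUnitalAlgHom.ext fun x => funext fun j => ?_
  change singleNonUnitalAlgHom (𝕂 := 𝕂) 𝕜 (e i) x (e j) = _
  rw [singleNonUnitalAlgHom_apply_apply, singleNonUnitalAlgHom_apply_apply]
  by_cases h : j = i
  · subst h
    rw [if_pos rfl, if_pos rfl]
  · rw [if_neg h, if_neg (fun h' => h (e.injective h'))]

/-- Over the zero coefficient ring every matrix is `0`, so `U(𝔤𝔩_m(0))` consists of scalars and its
centre is generated by nothing. [folklore] -/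
theorem center_matrix_le_bot_of_subsingleton {A : Type*} [CommRing A] [Algebra 𝕂 A] [Subsingleton A] :
    Subalgebra.center 𝕂 (UniversalEnvelopingAlgebra 𝕂 (Matrix m m A)) ≤ ⊥ := by
  intro u hu
  clear hu
  induction u using Literature.Algebra.Lie.UEnv.induction_on with
  | algebraMap r => exact Subalgebra.algebraMap_mem _ r
  | ι_mem X =>
    have hX : X = 0 := Matrix.ext fun i j => Subsingleton.elim _ _
    rw [hX, map_zero]
    exact Subalgebra.zero_mem _
  | mul a b ha hb => exact Subalgebra.mul_mem _ ha hb
  | add a b ha hb => exact Subalgebra.add_mem _ ha hb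

/-- Images of generation statements: if `Z ≤ adjoin S` then `φ(Z) ⊆ adjoin (φ '' S)`. [folklore] -/
theorem mem_adjoin_image_of_le {R A B : Type*} [CommSemiring R] [Semiring A] [Algebra R A] [Semiring B]
    [Algebra R B] (φ : A →ₐ[R] B) {Z : Subalgebra R A} {S : Set A} (h : Z ≤ Algebra.adjoin R S)
    {u : A} (hu : u ∈ Z) : φ u ∈ Algebra.adjoin R (φ '' S) := by
  rw [← AlgHom.map_adjoin]
  exact Subalgebra.mem_map.mpr ⟨u, h hu, rfl⟩

/-- **The centre of `U(𝔤𝔩_m(ι → 𝕜))` for a finite index type `ι` is generated by the images of the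
centre of `U(𝔤𝔩_m(𝕜))` under the coordinate inclusions** (induction on the finite type:
`Fintype.induction_empty_option`; the empty product is the zero ring, `Option ι → 𝕜 ≅ 𝕜 × (ι → 𝕜)`
and the binary case). [cite: Dixmier1977, 2.2.10 and 4.2] -/
theorem center_matrix_pi_le_adjoin (ι : Type u) [Fintype ι] [DecidableEq ι] :
    Subalgebra.center 𝕂 (UniversalEnvelopingAlgebra 𝕂 (Matrix m m (ι → 𝕜))) ≤
      Algebra.adjoin 𝕂 (⋃ i : ι, envMap (mapMatrixLie (N := m) (singleNonUnitalAlgHom (𝕂 := 𝕂) 𝕜 i)) ''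
        (Subalgebra.center 𝕂 (UniversalEnvelopingAlgebra 𝕂 (Matrix m m 𝕜)) : Set _)) := by
  revert ι
  refine fun ι _ => @Fintype.induction_empty_option
    (fun (α : Type u) _ => ∀ [DecidableEq α],
      Subalgebra.center 𝕂 (UniversalEnvelopingAlgebra 𝕂 (Matrix m m (α → 𝕜))) ≤
        Algebra.adjoin 𝕂 (⋃ i : α, envMap (mapMatrixLie (N := m) (singleNonUnitalAlgHom (𝕂 := 𝕂) 𝕜 i)) ''
          (Subalgebra.center 𝕂 (UniversalEnvelopingAlgebra 𝕂 (Matrix m m 𝕜)) : Set _)))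
    ?_ ?_ ?_ ι ‹_›
  · -- transport along a reindexing `(α → 𝕜) ≅ (β → 𝕜)`
    intro α β _ e ih _
    classical
    have hE := center_le_adjoin_of_algEquiv (m := m) (piReindexAlgEquiv 𝕂 𝕜 e.symm) ih
    refine hE.trans (Algebra.adjoin_le ?_)
    rintro _ ⟨u, hu, rfl⟩
    rw [Set.mem_iUnion] at hu
    obtain ⟨a, z, hz, rfl⟩ := hu
    rw [← AlgHom.comp_apply, ← envMap_comp, ← mapMatrixLie_comp]
    refine Algebra.subset_adjoin (Set.mem_iUnion.mpr ⟨e a, ⟨z, hz, ?_⟩⟩)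
    rw [← piReindexAlgEquiv_symm_comp_single 𝕜 e.symm (e a), Equiv.symm_apply_apply]
  · -- the empty product is the zero ring
    intro _
    exact (center_matrix_le_bot_of_subsingleton (𝕂 := 𝕂) (m := m)).trans bot_le
  · -- `Option α → 𝕜 ≅ 𝕜 × (α → 𝕜)` and the binary case
    intro α _ ih _
    classical
    have hE := center_le_adjoin_of_algEquiv (m := m) (piOptionAlgEquiv (𝕂 := 𝕂) 𝕜 α)
      (center_matrix_prod_le_adjoin (𝕂 := 𝕂) (A := 𝕜) (B := α → 𝕜) (m := m))
    refine hE.trans (Algebra.adjoin_le ?_)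
    rintro _ ⟨u, hu, rfl⟩
    rcases hu with ⟨z, hz, rfl⟩ | ⟨v, hv, rfl⟩
    · -- the factor `𝕜`: coordinate `none`
      rw [← AlgHom.comp_apply, ← envMap_comp, ← mapMatrixLie_comp, piOptionAlgEquiv_symm_comp_inl]
      exact Algebra.subset_adjoin (Set.mem_iUnion.mpr ⟨none, z, hz, rfl⟩)
    · -- the factor `α → 𝕜`: induction hypothesis, coordinates `some a`
      have hmap := mem_adjoin_image_of_le (envMap (mapMatrixLie (N := m)
        ((((piOptionAlgEquiv (𝕂 := 𝕂) 𝕜 α).symm : 𝕜 × (α → 𝕜) →ₐ[𝕂] (Option α → 𝕜)) :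
          𝕜 × (α → 𝕜) →ₙₐ[𝕂] (Option α → 𝕜)).comp (NonUnitalAlgHom.inr 𝕂 𝕜 (α → 𝕜))))) ih hv
      rw [Set.image_iUnion] at hmap
      rw [← AlgHom.comp_apply, ← envMap_comp, ← mapMatrixLie_comp]
      refine Algebra.adjoin_mono (Set.iUnion_subset fun a => ?_) hmap
      rw [image_envMap_comp, ← mapMatrixLie_comp, piOptionAlgEquiv_symm_comp_inr_comp_single]
      exact Set.subset_iUnion (fun b : Option α => envMap (mapMatrixLie (N := m)
        (singleNonUnitalAlgHom (𝕂 := 𝕂) 𝕜 b)) ''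
          (Subalgebra.center 𝕂 (UniversalEnvelopingAlgebra 𝕂 (Matrix m m 𝕜)) : Set _)) (some a)

end Pi

/-! ### 4. The centre of `U(𝔤𝔩_m(K_∞))` -/

section MixedSpace

open scoped Classical
open NumberField NumberField.InfinitePlace NumberField.mixedEmbedding

variable {K : Type*} [Field K] {m : ℕ}

/-- `realPlaceHom w` is the coordinate `w` of the real factor of `K_∞`. [folklore] -/
theorem realPlaceHom_eq_inl_comp_single (w : {w : InfinitePlace K // IsReal w}) :
    (realPlaceHom w : ℝ →ₙₐ[ℝ] mixedSpace K) =
      (NonUnitalAlgHom.inl ℝ ({w : InfinitePlace K // IsReal w} → ℝ) ({w : InfinitePlace K // IsComplex w} → ℂ)).comp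
        (singleNonUnitalAlgHom (𝕂 := ℝ) ℝ w) := by
  refine NonUnitalAlgHom.ext fun x => ?_
  rw [realPlaceHom_apply, NonUnitalAlgHom.comp_apply, NonUnitalAlgHom.inl_apply]
  refine Prod.ext (funext fun v => ?_) rfl
  change Pi.single (M := fun _ : {w : InfinitePlace K // IsReal w} => ℝ) w x v = singleNonUnitalAlgHom (𝕂 := ℝ) ℝ w x v
  rw [singleNonUnitalAlgHom_apply_apply, Pi.single_apply]

/-- `complexPlaceHom w` is the coordinate `w` of the complex factor of `K_∞`. [folklore] -/
theorem complexPlaceHom_eq_inr_comp_single (w : {w : InfinitePlace K // IsComplex w}) :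
    (complexPlaceHom w : ℂ →ₙₐ[ℝ] mixedSpace K) =
      (NonUnitalAlgHom.inr ℝ ({w : InfinitePlace K // IsReal w} → ℝ) ({w : InfinitePlace K // IsComplex w} → ℂ)).comp
        (singleNonUnitalAlgHom (𝕂 := ℝ) ℂ w) := by
  refine NonUnitalAlgHom.ext fun x => ?_
  rw [complexPlaceHom_apply, NonUnitalAlgHom.comp_apply, NonUnitalAlgHom.inr_apply]
  refine Prod.ext rfl (funext fun v => ?_)
  change Pi.single (M := fun _ : {w : InfinitePlace K // IsComplex w} => ℂ) w x v = singleNonUnitalAlgHom (𝕂 := ℝ) ℂ w x v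
  rw [singleNonUnitalAlgHom_apply_apply, Pi.single_apply]

/-- **The centre of `U(𝔤𝔩_m(K_∞))` is generated by the centres of the factors `U(𝔤𝔩_m(K_w))`.** For a
number field `K` with `K_∞ = mixedSpace K = ∏_{w real} ℝ × ∏_{w complex} ℂ`, every central element
of the real enveloping algebra `U(𝔤𝔩_m(K_∞))` lies in the subalgebra generated by the images of
`Z(U(𝔤𝔩_m(ℝ)))` under `U(realPlaceHom w)` (`w` real) and of `Z(U(𝔤𝔩_m(ℂ)))` under
`U(complexPlaceHom w)` (`w` complex). Clozel 1990, §3.3 (`𝔤_∞ = ⨁_w 𝔤𝔩_m(K_w)`, hence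
`Z(𝔤_∞) = ⊗_w Z(𝔤𝔩_m(K_w))`); Dixmier 2.2.10, 4.2. [cite: Clozel1990, §3.3] -/
theorem center_matrix_mixedSpace_le_adjoin [NumberField K] :
    Subalgebra.center ℝ (UniversalEnvelopingAlgebra ℝ (Matrix (Fin m) (Fin m) (mixedSpace K))) ≤
      Algebra.adjoin ℝ
        ((⋃ w : {w : InfinitePlace K // IsReal w},
            envMap (mapMatrixLie (N := Fin m) (realPlaceHom w)) ''
              (Subalgebra.center ℝ (UniversalEnvelopingAlgebra ℝ (Matrix (Fin m) (Fin m) ℝ)) : Set _)) ∪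
          ⋃ w : {w : InfinitePlace K // IsComplex w},
            envMap (mapMatrixLie (N := Fin m) (complexPlaceHom w)) ''
              (Subalgebra.center ℝ (UniversalEnvelopingAlgebra ℝ (Matrix (Fin m) (Fin m) ℂ)) : Set _)) := by
  refine (center_matrix_prod_le_adjoin (𝕂 := ℝ) (A := {w : InfinitePlace K // IsReal w} → ℝ)
    (B := {w : InfinitePlace K // IsComplex w} → ℂ) (m := Fin m)).trans (Algebra.adjoin_le ?_)
  rintro _ (⟨u, hu, rfl⟩ | ⟨u, hu, rfl⟩)
  · -- real factor
    have hmap := mem_adjoin_image_of_le (envMap (mapMatrixLie (N := Fin m)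
      (NonUnitalAlgHom.inl ℝ ({w : InfinitePlace K // IsReal w} → ℝ) ({w : InfinitePlace K // IsComplex w} → ℂ))))
      (center_matrix_pi_le_adjoin (𝕂 := ℝ) ℝ (m := Fin m) {w : InfinitePlace K // IsReal w}) hu
    rw [Set.image_iUnion] at hmap
    refine Algebra.adjoin_mono ?_ hmap
    refine Set.subset_union_of_subset_left (Set.iUnion_mono fun w => ?_) _
    rw [image_envMap_comp, ← mapMatrixLie_comp, ← realPlaceHom_eq_inl_comp_single]
  · -- complex factor
    have hmap := mem_adjoin_image_of_le (envMap (mapMatrixLie (N := Fin m)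
      (NonUnitalAlgHom.inr ℝ ({w : InfinitePlace K // IsReal w} → ℝ) ({w : InfinitePlace K // IsComplex w} → ℂ))))
      (center_matrix_pi_le_adjoin (𝕂 := ℝ) ℂ (m := Fin m) {w : InfinitePlace K // IsComplex w}) hu
    rw [Set.image_iUnion] at hmap
    refine Algebra.adjoin_mono ?_ hmap
    refine Set.subset_union_of_subset_right (Set.iUnion_mono fun w => ?_) _
    rw [image_envMap_comp, ← mapMatrixLie_comp, ← complexPlaceHom_eq_inr_comp_single]

end MixedSpace

end Literature.NumberTheory.Automorphic.UEnvMatrix
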